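import Summits.QuantumFields.BalabanUV.T4Continuum.Support.NE7CutoffDirIterCommutator
import HarnessLib

/-!
# NE7CutoffDirIterSplit — (N3)″'s SIZE LETTER: the linearised block average of a WEIGHTED direction field splits as `D_W(c·Y)(z,κ) = c₀·D_W Y(z,κ) + E(z,κ)` for ANY
# reference value `c₀` (no tangency asked of `Y`), with `‖E(z,κ)‖ ≤ osc·(majIter ‖Y‖ (z,κ) + frameMaj ‖Y‖ z + frameMaj ‖Y‖ (z+e_κ))`, `osc` the oscillation of the
# weight about `c₀` over the two dependency balls — F250's commutator letter WITHOUT the tangency hypothesis (the term `c₀·D_W Y` is kept instead of killed)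

Cell `pub-balaban`, rung (B)+1 sub-cell t4, lineage `b2b-balaban-t4-ne7-p1` (CRUX PROVER NE7 #1 = OWNER of row NE7), generation 89; memo
`t4/b2b-balaban-t4-ne7-p1-g89/COSTING-N1.md` §1, §5 (5).  File F258 (over F250 `NE7CutoffDirIterCommutator`'s proof pattern and its imports BY NAME: row NE3's LOCAL majorant
`NE3DirIterMajorant.norm_dirIter_le_majorant_local`, `ℝ`-linearity `NE3TangentCovariantTower.dirIter_add` ∕ `NE7CombSliceSourceDuality.dirIter_smul`, homogeneity
`majIter_smul` ∕ `frameMaj_smul`).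

WHY.  The v3 END (F257 `NE7ApeOfTorusRoadV3`) asks for a SPLIT of the chart's linearised top average `D_1(χ·A_loc) = φ₁ + E` with `φ₁` of controlled COARSE CURL and `E` of
controlled SIZE, supported on the shell.  With `c₀(z,κ) := χ` at the corner of the coarse bond, `φ₁ := c₀·D_1A_loc` and `E := D_1(χA_loc) − c₀·D_1A_loc`: THIS FILE is
the size bound of `E` — zero wherever `χ` is constant on the two dependency balls (off the shell), `≲ (nbRad∕R)·(majorants of ‖A_loc‖)` on the shell.  (The coarse curl of
`φ₁` — `χ`'s coarse oscillation times `D_1A_loc` plus `c₀` times the coarse curl of `D_1A_loc`, i.e. the datum's plaquette radius plus the linearisation error — is the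
successor's (N3)″ near part.)
WHAT ([folklore]; 0 def, 0 sorry).  **`norm_dirIter_weight_sub_le_osc_majorant`** (complex-coerced weight) and **`norm_dirIter_weight_sub_le_osc_majorant'`** (real
scalar action): for `W` in the class, `Y` skew periodic (NOT assumed tangent), `c` a periodic real weight, `(z, κ)` a coarse bond and `c₀, osc` with `|c − c₀| ≤ osc` on the
two dependency balls: `‖D_W(c·Y)(z,κ) − c₀·D_W Y(z,κ)‖ ≤ osc·(majIter + frameMaj + frameMaj)`.
HONEST FRAMING (page 1): lattice bookkeeping over row NE3's local majorant; nothing of Bałaban's asserted; NOT (APE), NOT ONE-STEP, NOT NE7; spine 0∕9; finite T⁴ rung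
(B)+1 — NOT infinite volume, NOT mass gap, NOT `BetaPertH`, NOT Clay.  Continuum YM on T⁴ ⇐ BetaPertH ∧ nine spine estimates (0/9 proved); BetaPertH ⇐ (D1) ∧ (D4) ∧
CAP+tail; G-an2-4 gates asym, D1 and NE2/3/4.
-/

set_option autoImplicit false

open scoped BigOperators Matrix.Norms.L2Operator
open NormedSpace Finset

namespace Summit.QuantumFields.BalabanUV.T4Continuum.NE7CutoffDirIterSplit

open Literature.MathematicalPhysics.QuantumFieldTheory.Balaban1983to89
open B7Prop1Explicit B7Prop2Explicit
open T4AveragingDeficitWall (IsUnitaryCfg IsSkewDir SmallField)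
open T4AveragingDeficitWallBoundary (IsPeriodicCfg)
open AveragingDeficitPeriodicCounting (IsPeriodicDir)
open AveragingDeficitMultiLevelPrep (LevelSmall tower)
open NE3TangentCovariantTower (dirIter dirIter_add)
open NE3QbarIterMajorant (majIter majIter_smul)
open NE3DirIterMajorant (frameMaj frameMaj_smul norm_dirIter_le_majorant_local)
open NE3QuadRemainderLocality (depRad)
open NE7CombSliceSourceDuality (dirIter_smul)

noncomputable section

variable {d : ℕ} {n : Type*} [Fintype n] [DecidableEq n]

/-- **`‖D_W(c·Y)(z,κ) − c₀·D_W Y(z,κ)‖ ≤ osc·(majIter ‖Y‖ + frameMaj ‖Y‖ z + frameMaj ‖Y‖ (z+e_κ))` FOR ANY SKEW PERIODIC `Y`** (no tangency): `c·Y = (c − c₀)·Y + c₀·Y`,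
`D_W` is `ℝ`-linear, and on the two dependency balls `‖(c − c₀)·Y‖ ≤ osc·‖Y‖`, which is what row NE3's local majorant asks. [folklore] -/
theorem norm_dirIter_weight_sub_le_osc_majorant [Nonempty n] {L M : ℕ} [NeZero M] (hL : 1 ≤ L) (j : ℕ)
    {W : Site d → Fin d → (Matrix n n ℂ)ˣ} {x : ℝ} (hWu : IsUnitaryCfg W) (hWP : IsPeriodicCfg W ((tower L M (j + 1) : ℕ) : ℤ))
    (hx : 0 ≤ x) (hs : LevelSmall d L j x) (hWx : SmallField W x)
    {Y : Site d → Fin d → Matrix n n ℂ} (hY : IsSkewDir Y) (hYP : IsPeriodicDir Y ((tower L M (j + 1) : ℕ) : ℤ))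
    (c : Site d → Fin d → ℝ) (hcP : ∀ (y : Site d) (i : Fin d) (μ : Fin d), c (y + ((tower L M (j + 1) : ℕ) : ℤ) • e i) μ = c y μ)
    (z : Site d) (κ : Fin d) {c₀ osc : ℝ}
    (hosc : ∀ (y : Site d) (μ : Fin d), (l1 (y - ((L : ℤ) ^ (j + 1)) • z) ≤ depRad d L (j + 1)
      ∨ l1 (y - ((L : ℤ) ^ (j + 1)) • (z + e κ)) ≤ depRad d L (j + 1)) → |c y μ - c₀| ≤ osc) :
    ‖dirIter L (j + 1) W (fun y μ => (c y μ : ℂ) • Y y μ) z κ - ((c₀ : ℂ)) • dirIter L (j + 1) W Y z κ‖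
      ≤ osc * (majIter d L (j + 1) x (fun y μ => ‖Y y μ‖) z κ + frameMaj d L (j + 1) x (fun y μ => ‖Y y μ‖) z
          + frameMaj d L (j + 1) x (fun y μ => ‖Y y μ‖) (z + e κ)) := by
  -- the weighted direction minus the constant part
  set Z : Site d → Fin d → Matrix n n ℂ := fun y μ => ((c y μ - c₀ : ℝ) : ℂ) • Y y μ with hZ
  have hZs : IsSkewDir Z := fun y μ => by
    have : ((c y μ - c₀ : ℝ) : ℂ) • Y y μ = (c y μ - c₀) • Y y μ := (Complex.coe_smul _ _)
    rw [hZ]; simp only [this]; exact skewAdjoint.smul_mem _ (hY y μ)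
  have hZP : IsPeriodicDir Z ((tower L M (j + 1) : ℕ) : ℤ) := fun y i μ => by simp only [hZ, hYP y i μ, hcP y i μ]
  -- `c·Y = Z + c₀·Y` and linearity
  have hsplit : (fun y μ => (c y μ : ℂ) • Y y μ) = fun y μ => Z y μ + (c₀ • Y) y μ := by
    funext y μ
    simp only [hZ, Pi.smul_apply]
    rw [show (c₀ • Y y μ : Matrix n n ℂ) = ((c₀ : ℝ) : ℂ) • Y y μ from (Complex.coe_smul _ _).symm, ← add_smul]
    congr 1; push_cast; ring
  have hlin : dirIter L (j + 1) W (fun y μ => (c y μ : ℂ) • Y y μ) z κ - ((c₀ : ℂ)) • dirIter L (j + 1) W Y z κ = dirIter L (j + 1) W Z z κ := by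
    rw [hsplit, dirIter_add hL j hWu hx hs hWx Z (c₀ • Y)]
    simp only
    rw [dirIter_smul hL j hWu hx hs hWx c₀ Y]
    simp only [Pi.smul_apply]
    rw [show (c₀ • dirIter L (j + 1) W Y z κ : Matrix n n ℂ) = ((c₀ : ℝ) : ℂ) • dirIter L (j + 1) W Y z κ from (Complex.coe_smul _ _).symm]
    abel
  rw [hlin]
  -- local domination of `Z` by `osc·‖Y‖` on the two dependency balls
  have hdom : ∀ (y : Site d) (μ : Fin d), (l1 (y - ((L : ℤ) ^ (j + 1)) • z) ≤ depRad d L (j + 1)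
      ∨ l1 (y - ((L : ℤ) ^ (j + 1)) • (z + e κ)) ≤ depRad d L (j + 1)) → ‖Z y μ‖ ≤ (fun y' μ' => osc * ‖Y y' μ'‖) y μ := by
    intro y μ hy
    simp only [hZ]
    rw [norm_smul, Complex.norm_real, Real.norm_eq_abs]
    exact mul_le_mul_of_nonneg_right (hosc y μ hy) (norm_nonneg _)
  have h := norm_dirIter_le_majorant_local (M := M) hL j hWu hWP hx hs hWx hZs hZP z κ hdom
  rw [majIter_smul, frameMaj_smul, frameMaj_smul] at h
  simp only at h
  linarith

/-- The same letter with the weighted direction spelled `fun y μ => c y μ • Y y μ` and the reference term `c₀ • D_W Y (z,κ)` (real scalar action). [folklore] -/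
theorem norm_dirIter_weight_sub_le_osc_majorant' [Nonempty n] {L M : ℕ} [NeZero M] (hL : 1 ≤ L) (j : ℕ)
    {W : Site d → Fin d → (Matrix n n ℂ)ˣ} {x : ℝ} (hWu : IsUnitaryCfg W) (hWP : IsPeriodicCfg W ((tower L M (j + 1) : ℕ) : ℤ))
    (hx : 0 ≤ x) (hs : LevelSmall d L j x) (hWx : SmallField W x)
    {Y : Site d → Fin d → Matrix n n ℂ} (hY : IsSkewDir Y) (hYP : IsPeriodicDir Y ((tower L M (j + 1) : ℕ) : ℤ))
    (c : Site d → Fin d → ℝ) (hcP : ∀ (y : Site d) (i : Fin d) (μ : Fin d), c (y + ((tower L M (j + 1) : ℕ) : ℤ) • e i) μ = c y μ)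
    (z : Site d) (κ : Fin d) {c₀ osc : ℝ}
    (hosc : ∀ (y : Site d) (μ : Fin d), (l1 (y - ((L : ℤ) ^ (j + 1)) • z) ≤ depRad d L (j + 1)
      ∨ l1 (y - ((L : ℤ) ^ (j + 1)) • (z + e κ)) ≤ depRad d L (j + 1)) → |c y μ - c₀| ≤ osc) :
    ‖dirIter L (j + 1) W (fun y μ => c y μ • Y y μ) z κ - c₀ • dirIter L (j + 1) W Y z κ‖
      ≤ osc * (majIter d L (j + 1) x (fun y μ => ‖Y y μ‖) z κ + frameMaj d L (j + 1) x (fun y μ => ‖Y y μ‖) z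
          + frameMaj d L (j + 1) x (fun y μ => ‖Y y μ‖) (z + e κ)) := by
  have hsp : (fun y μ => c y μ • Y y μ) = fun y μ => (c y μ : ℂ) • Y y μ := by
    funext y μ; exact (Complex.coe_smul _ _).symm
  have hc₀ : (c₀ • dirIter L (j + 1) W Y z κ : Matrix n n ℂ) = ((c₀ : ℝ) : ℂ) • dirIter L (j + 1) W Y z κ := (Complex.coe_smul _ _).symm
  rw [hsp, hc₀]
  exact norm_dirIter_weight_sub_le_osc_majorant hL j hWu hWP hx hs hWx hY hYP c hcP z κ hosc

end

end Summit.QuantumFields.BalabanUV.T4Continuum.NE7CutoffDirIterSplit
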